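import Summits.HodgeConjecture.HodgeConjecture.Theorems.VHCAbelianSchemesRoadTwistedDoorIsoRespects
import Literature.AlgebraicGeometry.HodgeTheory.TwistedPerfectAdmissibilityInitialSegment
import HarnessLib

/-!
# Road b02 (`VHCAbelianSchemesRoad`, D-0059) — the PRIMED twisted door `AdmTw' := gluableSigmaAdmissible ∨ bfSingleAdmissible'`
# (initial-segment repair of binder `TwistedPerfectDoor`, item stmt-HodgeConjecture-19275): it RESPECTS ISOMORPHISMS of `ℂ`-schemes
# unconditionally, is a SUB-door of `AdmTw`, and the binder of record transfers to it

research route conditional on HC_CM; not a corollary; Q11.4-sentence-2 already refuted in dim ≥ 3.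

FACT-FREE bookkeeping (seat ring2-b06 gen 120; helper `--supports stmt-HodgeConjecture-19275`; requested by the tenure planner's ask
`LEAD/ASK#door-admissibility-prime`; the route file, the binder of record and the crux skeleton v3.1 are untouched). The Literature
file `TwistedPerfectAdmissibilityInitialSegment.lean` types the door-slice audit's repair 1: `bfSingleAdmissible' := bfSingleAdmissible ∧
«{q | q+1 ∈ I} is an initial segment of ℕ»` (the domain on which Pridham's twisted criterion and the untwisted `I`-semiregularity agree,
Rem. 2.26 with Cor. 2.25), with its transport along scheme isomorphisms. THIS file records, for the road's shape
`AdmTw' n X₀ I E := Summit.Ventures.HSemireg.gluableSigmaAdmissible n X₀ I E ∨ bfSingleAdmissible' n X₀ I E` (spelled inline; no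
definition here):

* `admTw'_pullback_of_schemeIso` — `AdmTw'` is invariant under pull-back along isomorphisms of `ℂ`-schemes on bounded complexes of
  vector bundles (the venture's `gluableSigmaAdmissible_pullback_of_schemeIso`, gen 119, and `or_bfSingleAdmissible'_pullback_of_schemeIso`);
* **`twistedDoorPrime_respectsIso`** — the primed twisted door `twistedReflexiveClass C AdmTw'` RESPECTS ISOMORPHISMS, unconditionally
  (the displayed shape `∀ n ⦃Y Y'⦄ (e : Y' ≅ Y) I κ, 𝒪 n Y I κ → 𝒪 n Y' I (fun q ↦ e^*κ_q)` consumed by the road's kernel theorems);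
* `twistedReflexiveClass_admTw_of_admTw'` — the primed door is a SUB-door of the door of record `AdmTw` (memberwise);
* `twistedPerfectDoorVHC_admTw'_of_admTw` — the binder of record `TwistedPerfectDoorVHC C AdmTw` IMPLIES its primed restatement
  `TwistedPerfectDoorVHC C AdmTw'` (antitonicity), so a restate WEAKENS item 19275 and every consumer fed `AdmTw'`-data is served by either;
* `twistedReflexiveClass_admTw'_isShiftedInitialSegment_or` — a member of the primed door has `{1,…,n} ⊆ I` (σ-disjunct) or an
  initial-segment index set (BF disjunct): the door-slice audit's «B₀ = 0 or initial segment» reading, at the level of the index set.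

Nothing here says any cell, carrier statement, residual, K-SR♭∃, VHC, `HC_AV` or HC holds; `HC_CM` occurs nowhere; no statement of any
item is touched. References: [cite: BuchweitzFlenner2003, Def. 4.1 and §5 (I-semiregular), Thm. 5.1]
[cite: Pridham2024Semiregularity, Rem. 2.26 with Cor. 2.25] [cite: Perry2026Semiregularity, Thm. 1.1 (hypotheses)] [cite: Lieblich2006, Prop. 2.1.9].
-/

noncomputable section

open CategoryTheory CategoryTheory.Limits AlgebraicGeometry Topology
open AlgebraicGeometry.Scheme.Modules

namespace Summit.HodgeConjecture.HodgeConjecture.Ring2.SemiregularRepresentatives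

-- the cell's namespace repeats the summit name (`Summit.HodgeConjecture.HodgeConjecture…`), as in every `Ring2*` file
set_option linter.dupNamespace false

open Literature.AlgebraicGeometry Literature.AlgebraicGeometry.Motives Literature.AlgebraicGeometry.Modules
open Literature.AlgebraicGeometry.HodgeTheory
open Literature.AlgebraicGeometry.KTheory
open Literature.AlgebraicTopology.SingularHomology

/-- **The primed twisted admissibility `AdmTw' := gluableSigmaAdmissible ∨ bfSingleAdmissible'` is invariant under pull-back along
isomorphisms of `ℂ`-schemes** (on bounded complexes of vector bundles): the σ-disjunct by the venture's base-change theorem for the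
complex-level `σ_q` (`gluableSigmaAdmissible_pullback_of_schemeIso`), the primed BF disjunct by `bfSingleAdmissible'.pullback_of_schemeIso`.
[cite: BuchweitzFlenner2003, Def. 4.1 and §5 (I-semiregular)] [cite: Lieblich2006, Prop. 2.1.9] -/
theorem admTw'_pullback_of_schemeIso :
    ∀ (n : ℕ) ⦃Y Y' : SchemeOver ℂ⦄ (e : Y' ≅ Y) (I : Finset ℕ) (E : CochainComplex Y.left.Modules ℤ),
      IsBoundedVBComplex E →
        (Summit.Ventures.HSemireg.gluableSigmaAdmissible n Y I E ∨ bfSingleAdmissible' n Y I E) →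
        (Summit.Ventures.HSemireg.gluableSigmaAdmissible n Y' I
            (((Scheme.Modules.pullback e.hom.left).mapHomologicalComplex _).obj E) ∨
          bfSingleAdmissible' n Y' I (((Scheme.Modules.pullback e.hom.left).mapHomologicalComplex _).obj E)) :=
  or_bfSingleAdmissible'_pullback_of_schemeIso Summit.Ventures.HSemireg.gluableSigmaAdmissible_pullback_of_schemeIso

variable (C : ChernCharacterBetti)

/-- **The PRIMED twisted door `twistedReflexiveClass C AdmTw'`, `AdmTw' := gluableSigmaAdmissible ∨ bfSingleAdmissible'`, RESPECTS
ISOMORPHISMS of `ℂ`-schemes** — unconditionally; the displayed `hresp`/`h𝒪` shape of the road's kernel theorems for the restated binder.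
[cite: BuchweitzFlenner2003, Def. 4.1 and §5 (I-semiregular)] [cite: Perry2026Semiregularity, Thm. 1.1 (hypotheses)] -/
theorem twistedDoorPrime_respectsIso :
    ∀ (n : ℕ) ⦃Y Y' : SchemeOver ℂ⦄ (e : Y' ≅ Y) (I : Finset ℕ) (κ : (q : ℕ) → complexBetti Y (2 * q)),
      Literature.AlgebraicGeometry.HodgeTheory.twistedReflexiveClass C
          (fun n X₀ I E => Summit.Ventures.HSemireg.gluableSigmaAdmissible n X₀ I E ∨
            Literature.AlgebraicGeometry.HodgeTheory.bfSingleAdmissible' n X₀ I E) n Y I κ →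
        Literature.AlgebraicGeometry.HodgeTheory.twistedReflexiveClass C
          (fun n X₀ I E => Summit.Ventures.HSemireg.gluableSigmaAdmissible n X₀ I E ∨
            Literature.AlgebraicGeometry.HodgeTheory.bfSingleAdmissible' n X₀ I E) n Y' I
          (fun q ↦ complexBetti.map e.hom (2 * q) (κ q)) :=
  twistedReflexiveClass_respectsIso_or_bfSingle' C Summit.Ventures.HSemireg.gluableSigmaAdmissible_pullback_of_schemeIso

variable {C} {n : ℕ} {X₀ : SchemeOver ℂ} {I : Finset ℕ} {κ : (p : ℕ) → complexBetti X₀ (2 * p)}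

/-- **The primed door is a SUB-door of the door of record**: a member of `twistedReflexiveClass C AdmTw'` is a member of
`twistedReflexiveClass C AdmTw` (`bfSingleAdmissible' ⟹ bfSingleAdmissible`). [cite: Perry2026Semiregularity, Thm. 1.1 (hypotheses)] -/
theorem twistedReflexiveClass_admTw_of_admTw'
    (h : Literature.AlgebraicGeometry.HodgeTheory.twistedReflexiveClass C
      (fun n X₀ I E => Summit.Ventures.HSemireg.gluableSigmaAdmissible n X₀ I E ∨
        Literature.AlgebraicGeometry.HodgeTheory.bfSingleAdmissible' n X₀ I E) n X₀ I κ) :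
    Literature.AlgebraicGeometry.HodgeTheory.twistedReflexiveClass C
      (fun n X₀ I E => Summit.Ventures.HSemireg.gluableSigmaAdmissible n X₀ I E ∨
        Literature.AlgebraicGeometry.HodgeTheory.bfSingleAdmissible n X₀ I E) n X₀ I κ :=
  twistedReflexiveClass_or_bfSingle_of_or_bfSingle' C h

/-- **The index set of a member of the primed door**: either the σ-disjunct's cell clause `{1, …, n} ⊆ I` holds, or `{q | q+1 ∈ I}`
is an initial segment of `ℕ` (the primed BF disjunct) — the door-slice audit's reading «σ-disjunct, or BF with initial-segment `I`» at
the level of `I`. [cite: BuchweitzFlenner2003, §5 (I-semiregular)] [cite: Pridham2024Semiregularity, Rem. 2.26 with Cor. 2.25] -/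
theorem twistedReflexiveClass_admTw'_isShiftedInitialSegment_or
    (h : Literature.AlgebraicGeometry.HodgeTheory.twistedReflexiveClass C
      (fun n X₀ I E => Summit.Ventures.HSemireg.gluableSigmaAdmissible n X₀ I E ∨
        Literature.AlgebraicGeometry.HodgeTheory.bfSingleAdmissible' n X₀ I E) n X₀ I κ) :
    Finset.Icc 1 n ⊆ I ∨ I.IsShiftedInitialSegment := by
  obtain ⟨E, -, -, hA, -, -, -⟩ := h
  exact hA.imp (fun hσ p hp => hσ.1 p (Finset.mem_Icc.1 hp).1 (Finset.mem_Icc.1 hp).2) fun hbf => hbf.2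

variable (C)

/-- **The binder of record transfers to the primed restatement**: `TwistedPerfectDoorVHC C AdmTw ⟹ TwistedPerfectDoorVHC C AdmTw'`
(antitonicity of the door statement in the admissibility notion) — restating item 19275 with `AdmTw'` WEAKENS it, and every consumer
that feeds `AdmTw'`-admissible data is served by the binder of record as well. [cite: BuchweitzFlenner2003, §5 Thm. 5.1 (binder shape)] -/
theorem twistedPerfectDoorVHC_admTw'_of_admTw
    (h : TwistedPerfectDoorVHC C
      (fun n X₀ I E => Summit.Ventures.HSemireg.gluableSigmaAdmissible n X₀ I E ∨
        Literature.AlgebraicGeometry.HodgeTheory.bfSingleAdmissible n X₀ I E)) :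
    TwistedPerfectDoorVHC C
      (fun n X₀ I E => Summit.Ventures.HSemireg.gluableSigmaAdmissible n X₀ I E ∨
        Literature.AlgebraicGeometry.HodgeTheory.bfSingleAdmissible' n X₀ I E) :=
  TwistedPerfectDoorVHC.or_bfSingle'_of_or_bfSingle C h

end Summit.HodgeConjecture.HodgeConjecture.Ring2.SemiregularRepresentatives

end
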